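import Summits.Ventures.PercRepro.GenQLargeCorankNum

/-!
# PercRepro — the `(8, 6)` cell: the large coranks, THE NUMERICS at `t = 5` AND THE THEOREM (night-4, gen 5)

`0 ≤ lbSum 5 n` for `25 ≤ n ≤ 43` (one `norm_num` lemma per case), `lbSum_nonneg` (with the `t = 3, 4` lemmas of
`GenQLargeCorankNum`), and the theorem of the cell:

* **`jq_nonneg_of_large`**: on a rank-`6` set `G` of the core with `25 ≤ |G| ≤ 43`, `0 ≤ Jq M G 6 t` for `3 ≤ t ≤ 5`;
* `jq_nonneg_of_large'`: the same for `t = 3, 4` from `22 ≤ |G|`.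

With the dual certificates at the coranks `≤ 15` (`t = 3, 4`) and `≤ 18` (`t = 5`; the window `8 … 13` on the rows of
record) this is every corank of `HighLayersCoreFree 6` (`|G| ≤ 43` on the core: `card_le_fortythree_of_core_of_ten`).
Imports `GenQLargeCorankNum`.
-/
namespace PercRepro.Night4

open Finset ThmH SixFour GenQ PerFlat Star

variable {α : Type} [DecidableEq α] {M : Matroid α} [M.Finite]

/-! ## One lemma per `n`, `t = 5` -/

/-- The numerics at `t = 5`, `n = 25`: `0 ≤ lbSum 5 25`. -/
theorem lb_5_25 : 0 ≤ lbSum 5 25 := by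
  simp only [lbSum, gLB, Lw, muL, kap, Finset.sum_range_succ, Finset.sum_range_zero]
  norm_num [Nat.choose_eq_factorial_div_factorial, Nat.factorial]

/-- The numerics at `t = 5`, `n = 26`: `0 ≤ lbSum 5 26`. -/
theorem lb_5_26 : 0 ≤ lbSum 5 26 := by
  simp only [lbSum, gLB, Lw, muL, kap, Finset.sum_range_succ, Finset.sum_range_zero]
  norm_num [Nat.choose_eq_factorial_div_factorial, Nat.factorial]

/-- The numerics at `t = 5`, `n = 27`: `0 ≤ lbSum 5 27`. -/
theorem lb_5_27 : 0 ≤ lbSum 5 27 := by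
  simp only [lbSum, gLB, Lw, muL, kap, Finset.sum_range_succ, Finset.sum_range_zero]
  norm_num [Nat.choose_eq_factorial_div_factorial, Nat.factorial]

/-- The numerics at `t = 5`, `n = 28`: `0 ≤ lbSum 5 28`. -/
theorem lb_5_28 : 0 ≤ lbSum 5 28 := by
  simp only [lbSum, gLB, Lw, muL, kap, Finset.sum_range_succ, Finset.sum_range_zero]
  norm_num [Nat.choose_eq_factorial_div_factorial, Nat.factorial]

/-- The numerics at `t = 5`, `n = 29`: `0 ≤ lbSum 5 29`. -/
theorem lb_5_29 : 0 ≤ lbSum 5 29 := by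
  simp only [lbSum, gLB, Lw, muL, kap, Finset.sum_range_succ, Finset.sum_range_zero]
  norm_num [Nat.choose_eq_factorial_div_factorial, Nat.factorial]

/-- The numerics at `t = 5`, `n = 30`: `0 ≤ lbSum 5 30`. -/
theorem lb_5_30 : 0 ≤ lbSum 5 30 := by
  simp only [lbSum, gLB, Lw, muL, kap, Finset.sum_range_succ, Finset.sum_range_zero]
  norm_num [Nat.choose_eq_factorial_div_factorial, Nat.factorial]

/-- The numerics at `t = 5`, `n = 31`: `0 ≤ lbSum 5 31`. -/
theorem lb_5_31 : 0 ≤ lbSum 5 31 := by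
  simp only [lbSum, gLB, Lw, muL, kap, Finset.sum_range_succ, Finset.sum_range_zero]
  norm_num [Nat.choose_eq_factorial_div_factorial, Nat.factorial]

/-- The numerics at `t = 5`, `n = 32`: `0 ≤ lbSum 5 32`. -/
theorem lb_5_32 : 0 ≤ lbSum 5 32 := by
  simp only [lbSum, gLB, Lw, muL, kap, Finset.sum_range_succ, Finset.sum_range_zero]
  norm_num [Nat.choose_eq_factorial_div_factorial, Nat.factorial]

/-- The numerics at `t = 5`, `n = 33`: `0 ≤ lbSum 5 33`. -/
theorem lb_5_33 : 0 ≤ lbSum 5 33 := by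
  simp only [lbSum, gLB, Lw, muL, kap, Finset.sum_range_succ, Finset.sum_range_zero]
  norm_num [Nat.choose_eq_factorial_div_factorial, Nat.factorial]

/-- The numerics at `t = 5`, `n = 34`: `0 ≤ lbSum 5 34`. -/
theorem lb_5_34 : 0 ≤ lbSum 5 34 := by
  simp only [lbSum, gLB, Lw, muL, kap, Finset.sum_range_succ, Finset.sum_range_zero]
  norm_num [Nat.choose_eq_factorial_div_factorial, Nat.factorial]

/-- The numerics at `t = 5`, `n = 35`: `0 ≤ lbSum 5 35`. -/
theorem lb_5_35 : 0 ≤ lbSum 5 35 := by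
  simp only [lbSum, gLB, Lw, muL, kap, Finset.sum_range_succ, Finset.sum_range_zero]
  norm_num [Nat.choose_eq_factorial_div_factorial, Nat.factorial]

/-- The numerics at `t = 5`, `n = 36`: `0 ≤ lbSum 5 36`. -/
theorem lb_5_36 : 0 ≤ lbSum 5 36 := by
  simp only [lbSum, gLB, Lw, muL, kap, Finset.sum_range_succ, Finset.sum_range_zero]
  norm_num [Nat.choose_eq_factorial_div_factorial, Nat.factorial]

/-- The numerics at `t = 5`, `n = 37`: `0 ≤ lbSum 5 37`. -/
theorem lb_5_37 : 0 ≤ lbSum 5 37 := by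
  simp only [lbSum, gLB, Lw, muL, kap, Finset.sum_range_succ, Finset.sum_range_zero]
  norm_num [Nat.choose_eq_factorial_div_factorial, Nat.factorial]

/-- The numerics at `t = 5`, `n = 38`: `0 ≤ lbSum 5 38`. -/
theorem lb_5_38 : 0 ≤ lbSum 5 38 := by
  simp only [lbSum, gLB, Lw, muL, kap, Finset.sum_range_succ, Finset.sum_range_zero]
  norm_num [Nat.choose_eq_factorial_div_factorial, Nat.factorial]

/-- The numerics at `t = 5`, `n = 39`: `0 ≤ lbSum 5 39`. -/
theorem lb_5_39 : 0 ≤ lbSum 5 39 := by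
  simp only [lbSum, gLB, Lw, muL, kap, Finset.sum_range_succ, Finset.sum_range_zero]
  norm_num [Nat.choose_eq_factorial_div_factorial, Nat.factorial]

/-- The numerics at `t = 5`, `n = 40`: `0 ≤ lbSum 5 40`. -/
theorem lb_5_40 : 0 ≤ lbSum 5 40 := by
  simp only [lbSum, gLB, Lw, muL, kap, Finset.sum_range_succ, Finset.sum_range_zero]
  norm_num [Nat.choose_eq_factorial_div_factorial, Nat.factorial]

/-- The numerics at `t = 5`, `n = 41`: `0 ≤ lbSum 5 41`. -/
theorem lb_5_41 : 0 ≤ lbSum 5 41 := by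
  simp only [lbSum, gLB, Lw, muL, kap, Finset.sum_range_succ, Finset.sum_range_zero]
  norm_num [Nat.choose_eq_factorial_div_factorial, Nat.factorial]

/-- The numerics at `t = 5`, `n = 42`: `0 ≤ lbSum 5 42`. -/
theorem lb_5_42 : 0 ≤ lbSum 5 42 := by
  simp only [lbSum, gLB, Lw, muL, kap, Finset.sum_range_succ, Finset.sum_range_zero]
  norm_num [Nat.choose_eq_factorial_div_factorial, Nat.factorial]

/-- The numerics at `t = 5`, `n = 43`: `0 ≤ lbSum 5 43`. -/
theorem lb_5_43 : 0 ≤ lbSum 5 43 := by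
  simp only [lbSum, gLB, Lw, muL, kap, Finset.sum_range_succ, Finset.sum_range_zero]
  norm_num [Nat.choose_eq_factorial_div_factorial, Nat.factorial]

/-- **The numerics**: `0 ≤ lbSum t n` for `3 ≤ t ≤ 5` and `22 ≤ n ≤ 43`, except `t = 5` with `n ≤ 24`. -/
theorem lbSum_nonneg {t n : ℕ} (ht3 : 3 ≤ t) (ht : t ≤ 5) (h22 : 22 ≤ n) (h43 : n ≤ 43)
    (hwin : t ≤ 4 ∨ 25 ≤ n) : 0 ≤ lbSum t n := by
  interval_cases t
  · interval_cases n
    · exact lb_3_22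
    · exact lb_3_23
    · exact lb_3_24
    · exact lb_3_25
    · exact lb_3_26
    · exact lb_3_27
    · exact lb_3_28
    · exact lb_3_29
    · exact lb_3_30
    · exact lb_3_31
    · exact lb_3_32
    · exact lb_3_33
    · exact lb_3_34
    · exact lb_3_35
    · exact lb_3_36
    · exact lb_3_37
    · exact lb_3_38
    · exact lb_3_39
    · exact lb_3_40
    · exact lb_3_41
    · exact lb_3_42
    · exact lb_3_43
  · interval_cases n
    · exact lb_4_22
    · exact lb_4_23
    · exact lb_4_24
    · exact lb_4_25
    · exact lb_4_26
    · exact lb_4_27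
    · exact lb_4_28
    · exact lb_4_29
    · exact lb_4_30
    · exact lb_4_31
    · exact lb_4_32
    · exact lb_4_33
    · exact lb_4_34
    · exact lb_4_35
    · exact lb_4_36
    · exact lb_4_37
    · exact lb_4_38
    · exact lb_4_39
    · exact lb_4_40
    · exact lb_4_41
    · exact lb_4_42
    · exact lb_4_43
  · interval_cases n
    · omega
    · omega
    · omega
    · exact lb_5_25
    · exact lb_5_26
    · exact lb_5_27
    · exact lb_5_28
    · exact lb_5_29
    · exact lb_5_30
    · exact lb_5_31
    · exact lb_5_32
    · exact lb_5_33
    · exact lb_5_34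
    · exact lb_5_35
    · exact lb_5_36
    · exact lb_5_37
    · exact lb_5_38
    · exact lb_5_39
    · exact lb_5_40
    · exact lb_5_41
    · exact lb_5_42
    · exact lb_5_43

/-- **THE LARGE CORANKS OF THE `(8, 6)` CELL**: on a rank-`6` set `G` of the core with `25 ≤ |G| ≤ 43`, the
type-`t` balance is `≥ 0` for every `3 ≤ t ≤ 5` — no certificate. -/
theorem jq_nonneg_of_large (hh : CoreHyps M) {G : Finset α} (hG : G ⊆ gr M)
    (hrG : M.eRk (G : Set α) = ((6 : ℕ) : ℕ∞)) {t : ℕ} (ht3 : 3 ≤ t) (ht : t ≤ 5) (h25 : 25 ≤ G.card)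
    (h43 : G.card ≤ 43) : 0 ≤ Jq M G 6 t :=
  (lbSum_nonneg ht3 ht (by omega) h43 (Or.inr h25)).trans (lbSum_le_Jq hh hG hrG ht)

/-- The same at types `3` and `4` from `22 ≤ |G|`. -/
theorem jq_nonneg_of_large' (hh : CoreHyps M) {G : Finset α} (hG : G ⊆ gr M)
    (hrG : M.eRk (G : Set α) = ((6 : ℕ) : ℕ∞)) {t : ℕ} (ht3 : 3 ≤ t) (ht : t ≤ 4) (h22 : 22 ≤ G.card)
    (h43 : G.card ≤ 43) : 0 ≤ Jq M G 6 t :=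
  (lbSum_nonneg ht3 (by omega) h22 h43 (Or.inl ht)).trans (lbSum_le_Jq hh hG hrG (by omega))

end PercRepro.Night4
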